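import Literature.MathematicalPhysics.QuantumFieldTheory.Balaban1983to89.T4MeanLipschitzBirth
import Literature.Analysis.Calculus.ExpLocalLieSubalgebra

/-!
# T4DirectionChart — the (β)-node segment RE-BASED at a non-flat configuration: the covariant transport identity
for the plaquettes of `b ↦ exp(c·𝐀(b))·U₀(b)`, the direction window, and `MeanLipschitz` relative to the base
(cell `pub-balaban`, self-assigned kernel row T4-O3.E-i′-Oβ3-RECHART* under the T4 carver's yield clause; the
follow-up named in the record `t4/T4-EST-O3Ei1-beta3t.md` v3 §9.4 (iv), regime (R-d) of its §9.3; bookkeeping only)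

HONEST FRAMING (cell `pub-balaban`, T4-DAG PAGE 1).  The cell's T4 target is the existence AND uniqueness of the
continuum limit of Bałaban's unit-scale averaged loop expectations on a finite torus — a constructive-QFT statement
strictly beyond ultraviolet stability ([Balaban1989LargeFieldII] Thm 1 p. 355); it is NOT the Yang–Mills mass gap and
NOT the Clay problem.  This module is ELEMENTARY NORMED-ALGEBRA BOOKKEEPING.  The siblings `T4SegmentCurvature` and
`T4MeanLipschitzBirth` control a conditional mean along the segment `s ↦ (b ↦ exp(iξ·s·A_u(b)))` from the FLAT
configuration `1` (`s = 0`) to the axial-gauge representative `exp(iξA_u)` of an exterior configuration `u`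
(`s = 1`); their tube needs a gauge `N u` dominating the axial potential `A_u` AND its difference quotients, and the
cell's record (`t4/T4-EST-O3Ei1-beta3t.md` v3 §9, regime (R-c)) found NO printed supplier of difference-quotient
bounds for the axial-gauge potential of a general exterior.  Print itself moves configurations differently: AROUND A
NON-FLAT, REGULAR BASE `U₀` along a DIRECTION `𝐀`, `𝐔′ = exp(iξ𝐀)U₀` ([Balaban1987RG1] (3.10) p. 272, quoted
below), the direction lying in a window `|𝐀|, |P₁𝐀|, |∇^ξ_U𝐀|, |Δ^ξ_U𝐀| < α₂` ((3.14)) and the analytic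
parameter being the complex coefficient of the direction (the Cauchy integral (3.15) p. 273).  What is typed here is
the normed-algebra skeleton of that chart, so that the segment argument of `T4AxialChain.meanLipschitz_of_segment`
runs RELATIVE TO A NON-FLAT BASE with the regularity demand placed on the DIRECTION (an input norm) instead of on the
exterior:
* §1 [folklore] PARALLEL TRANSPORT by units (`transport u A = u·A·u⁻¹`, additive, `ℂ`-linear,
  `exp (transport u X) = u·exp X·u⁻¹` — Mathlib `NormedSpace.exp_units_conj`), G-VALUED units in the cell's
  dictionary (`GUnit u`: `u` and `u⁻¹` are contractions; closed under products and inverses; transport by them is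
  norm-non-increasing and moves `A` by at most `2‖u − 1‖·‖A‖`), the BASE PLAQUETTE VARIABLE
  `basePlaq U₁ U₂ U₃ U₄ = U₁U₂U₃⁻¹U₄⁻¹` and the COVARIANT PLAQUETTE SUM `covSum` = the oriented sum of the four
  potentials of the direction transported to the plaquette's base point along its boundary
  (`A₁ + U₁A₂U₁⁻¹ − WA₃W⁻¹ − P₀A₄P₀⁻¹`, `W = U₁U₂U₃⁻¹`, `P₀ = basePlaq`), compared with the exactly covariant
  variant `covSum' = A₁ + U₁A₂U₁⁻¹ − U₄A₃U₄⁻¹ − A₄` (`ξ` times two covariant difference quotients in the cell's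
  dictionary) up to `2‖P₀ − 1‖(‖A₃‖ + ‖A₄‖)` (`norm_covSum_sub_covSum'_le`).
* §2 [folklore] THE COVARIANT TRANSPORT IDENTITY.  The plaquette variable of the MOVED configuration
  `b ↦ exp(c·A(b))·U(b)` (backward bonds carry the inverse `U(b)⁻¹·exp(−c·A(b))`, `bond_mul_bondInv`, via the
  landed `Literature.Analysis.Calculus.exp_mul_exp_neg` / `exp_neg_mul_exp` over the `ℝ`-structure restricted from `ℂ`),
  `movedPlaq c U A = exp(cA₁)U₁·exp(cA₂)U₂·U₃⁻¹exp(−cA₃)·U₄⁻¹exp(−cA₄)`, EQUALS the pure-potential plaquette of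
  the transported potentials times the base plaquette:
  `movedPlaq = exp(cÃ₁)·exp(cÃ₂)·exp(−cÃ₃)·exp(−cÃ₄)·P₀` (`movedPlaq_eq`) — so every §2 lemma of
  `T4SegmentCurvature` applies to the first factor verbatim; for a contractive base plaquette
  `‖movedPlaq − 1‖ ≤ ‖(pure-potential plaquette of Ã) − 1‖ + ‖P₀ − 1‖` (`norm_movedPlaq_sub_one_le`), whence in
  curvature units (`‖c‖ = ξσ`, transported potentials `≤ a`, `‖covSum‖ ≤ 2ξa′`, `4ξσa ≤ 1`, base curvature
  `‖P₀ − 1‖ ≤ δ_b ξ²`) `‖movedPlaq − 1‖ ≤ ξ²·(δ_b + 2σa′ + 16σ²a²)` (`norm_movedPlaq_sub_one_le_xi_sq`).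
* §3 [bookkeeping] THE DIRECTION WINDOW AND THE CHART CONDITION (constants explicit, the cell's; cf. the printed
  sentence "there exists a constant α₂, depending on α₀ and on some absolute constants" p. 272, whose SHAPE — for
  the curvature clause only — this reproduces): a G-valued base inside HALF the curvature domain
  (`‖P₀ − 1‖ ≤ ½α₀ξ²`, cf. the printed base space `U^c_j(X, ½α₀, ½α₁, α₀)` of (3.16)) and a direction in the
  window `α₂ = α₀/8` (transported sizes `≤ α₂`, `‖covSum‖ ≤ 2ξα₂`) give a moved configuration inside the FULL
  curvature domain, `‖movedPlaq c − 1‖ ≤ α₀ξ²` for every complex coefficient `‖c‖ ≤ ξ`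
  (`norm_movedPlaq_sub_one_le_of_window`, `0 < α₀ ≤ 1`); along the complexified segment (excursion
  `σ ≤ 1 + α₁′/dev`, gauges `a, a′ ≤ N ≤ dev`) the sufficient condition is `dev + α₁′ ≤ α₀/8`
  (`chart_condition` = the sibling's `segment_condition` at `½α₀`, `norm_movedPlaq_sub_one_le_of_condition`).
* §4 [bookkeeping] THE TUBE OF THE CHART AND THE DISC INCLUSION.  `dirTube ξ α₀ α₁′ t plaq A U N` = the complex
  parameters `s` with (C1) `|Im s|·N ≤ α₁′`, (C2) `|Re s|·N ≤ t`, (C3) `‖dirPlaq (iξs) A U p − 1‖ ≤ α₀ξ²` on `plaq`,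
  (C4) the same at `iξ·Re s` — the sibling's plaquette-level MODEL of the four small-field clauses, written for the
  moved configuration `exp(iξs𝐀)U₀ = exp(iξ·i(Im s)𝐀)·(exp(iξ(Re s)𝐀)U₀)`; `N` is the instantiating seat's gauge
  of the DIRECTION (intended: the sup of `|𝐀|` and of its covariant difference quotients `|∇^ξ_{U₀}𝐀|`, the first
  and third members of the printed window (3.14), so that the `∇`-halves of (1.12)/(1.13) for the moved
  configuration ride on (C1)/(C2) — a READING, not modelled).  `closedBall_subset_dirTube`: G-valued base with
  curvature `≤ δ_bξ²`, `δ_b ≤ ½α₀`, direction `‖A i‖ ≤ N ≤ dev`, `‖covSumAt A U p‖ ≤ 2ξN`, `0 < dev`,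
  `dev + α₁′ ≤ α₀/8`, `α₀ ≤ 1`, `0 < ξ ≤ 1`, `dev + α₁′ ≤ t` ⇒ every closed disc of radius `α₁′/dev` about a point
  of `[0, 1]` lies in the tube.
* §5 [bookkeeping] THE ASSEMBLY RELATIVE TO THE BASE.  `meanLipschitz_chart`: per exterior `u ∈ dom` a direction
  `A u` with gauge `0 ≤ N u ≤ dev u` and the data above, and — the ONLY analytic input, a HYPOTHESIS — an analytic
  slice bounded by `B` ON THE TUBE with endpoints `m u₀ b` (`s = 0`, the BASE) and `m u b` (`s = 1`) give
  `T4FirstOrderSize.MeanLipschitz dom m S u₀ dev (4B/α₁′)` with `u₀` := the base; the configuration-level leaf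
  (finite bond set) `dirConfig ξ A U s = (i ↦ exp(iξs·A i)·U i)` is an entire function of `s`
  (`differentiable_dirConfig`), equal to the base configuration at `s = 0`, and a functional `Mc` complex
  differentiable and bounded on a class `𝒞` of link configurations CONTAINING the chart images of the tube gives the
  slice (`meanLipschitz_chart_of_class`); with `MeanVanishes` at the base AS A HYPOTHESIS the conditional-mean
  suppression follows (`condMeanSuppression_chart_of_class`) — at a NON-FLAT base that hypothesis is NOT the
  reflection-symmetry consequence available at the flat configuration and stays the consumer's.
WHAT THE RE-BASING TRADES (the cell's located reading, `t4/T4-EST-O3Ei1-beta3t.md` v4 §10; NOT a theorem about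
Bałaban's objects): the regularity demand of the flat chart on the EXTERIOR's axial-gauge potential (no printed
supplier for general exteriors) becomes (a) regularity of the BASE — print's base in (3.10) is the background
configuration `U_{k+1}`, whose regular local gauges are printed ([Balaban1985Variational] Thm 1 (9)–(10), read through
[Balaban1987RG1] (1.17) p. 263) — and (b) the window (3.14) of the DIRECTION, an INPUT norm, which print verifies for
its own directions `𝐀 = 𝐇_j(B(t)) + t_□⟨…⟩` ("it follows only from the fact that 𝐇_j(B(t)) satisfies (3.14) with
1/3α₂, and δ𝐇_j satisfies (3.9)", p. 273).
NOT DISCHARGED here, stated so that nobody reads more into the module: (a) the clauses (1.12)/(1.13) of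
[Balaban1987RG1] p. 262 for the moved configuration beyond the size clauses (C1)/(C2) (existence of the local regular
gauges of `exp(iξ(Re s)𝐀)U₀` from those of `U₀`; the covariant derivative in (1.13) is with respect to the moved
G-valued part, not `U₀`); (b) the `|𝐉| < γ₀` half of (1.14), the substituted variable `𝐉′` of (3.10) and the
second/fourth members `|P₁𝐀|`, `|Δ^ξ_U𝐀|` of (3.14); (c) the TOWER condition (iv) ((1.15)/(1.16)) along the chart;
(d) the G^c-gauge covariance of the conditional mean (obligation O-β3-b); (e) the identification of `dirTube`/`𝒞`
with (a subset of) any printed space `𝐔^c_j(X, α₀, α₁)`, of `Mc`/`m` with Bałaban's conditional means or with the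
function (3.13), of `N u`, `dev u` with norms of an actual direction, and of the base with any printed configuration;
(f) `MeanVanishes` at a non-flat base; (g) analyticity of the function moved ((3.13) is printed analytic on the
stated space — a located fact about print's function, not about the cell's `Mc`).  All remain the instantiating
seat's readings and HYPOTHESES.  Value = kernel bookkeeping re-basing the (β) node's segment; NOT summit progress; NO
statement about Bałaban's renormalization-group objects is asserted.

MOTIVATING PRINTED LOCI (verbatim, journal page numbers; CONTEXT ONLY — nothing below is a formalisation of them).
* [Balaban1987RG1] (CMP 109) p. 272, the chart: "To fulfill the conditions of the inductive assumption we have to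
  construct an analytic extension of the expression (3.7). Let us consider more generally the function
  𝐄^{(j)}(X, exp iξ𝐀U_{k+1}). It is obtained from the analytic function 𝐄^{(j)}(X, 𝐔′, 𝐉′) by the substitution
  𝐔′ = exp iξ𝐀U_{k+1}, 𝐉′ = D^{ξ*}_{exp iξ𝐀U_{k+1}} ξ^{−2}π Im ∂ exp iξ𝐀U_{k+1}. (3.10) We expand the expression
  on the right-hand side above with respect to 𝐀 using the formulas (1.43)–(1.54) [14]. We obtain more generally,
  for any regular configuration U  D^{ξ*}_{exp iξ𝐀U} ξ^{−2}π Im ∂ exp iξ𝐀U = D^{ξ*}_U ξ^{−2}π Im ∂U + D^{ξ*}_U D^ξ_U 𝐀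
  + 𝐅(U, 𝐀), (3.11) where 𝐅 is a local operator depending on U, ∂U, 𝐀, ∇^ξ_U𝐀 only."
  [cite: Balaban1987RG1, (3.10)–(3.11) p. 272]
* [Balaban1987RG1] (CMP 109) p. 272, the direction window: "We consider it on the space U^c_j(X, 1/2α₀, 1/2α₁, α₀)
  (notice the different constant in the bound for 𝐉). It is an analytic function on this space, and also an
  analytic function of 𝐀, for 𝐀, ∇^ξ_U𝐀, Δ^ξ_U𝐀 sufficiently small. These restrictions can be easily obtained from
  the definition of the spaces, and from the form of the expressions in (3.13). Thus, there exists a constant α₂,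
  depending on α₀ and on some absolute constants, such that the function (3.13) is analytic in 𝐀, for 𝐀 satisfying
  the conditions |𝐀|, |P₁𝐀|, |∇^ξ_U𝐀|, |Δ^ξ_U𝐀| < α₂ on X. (3.14) Of course, on these spaces of configurations
  𝐔, 𝐉, 𝐀 the function (3.13) satisfies the inequality (1.18)."  [cite: Balaban1987RG1, (3.13)–(3.14) p. 272]
* [Balaban1987RG1] (CMP 109) p. 273, the Cauchy estimate in the coefficient of the direction: "The derivative with
  respect to t_□, at t_□ = 0, can be written as the Cauchy integral (1/2πi) ∫_{|t_□|=r} dt_□ (1/t_□²) 𝐄^{(j)}(X, …,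
  …), (3.15) with the radius r given by the equality r max{|δ𝐇_j|_X, |P₁δ𝐇_j|_X, |∇^ξ_𝐔δ𝐇_j|_X, |Δ^ξ_𝐔δ𝐇_j|_X}
  = ⅓α₂. We assume also that ε₁ is so small that 𝐇_j(B(t)) satisfies (3.14) with 1/3α₂ on the right-hand side.
  Thus we have constructed the analytic extension (3.15) of the function (3.7), defined on the space
  U^c_j(X, ½α₀, ½α₁, α₀) ∩ {(𝐔, 𝐉): 𝐔, 𝐉 satisfy the conditions (i)–(iii) for j = k + 1, and with the constants
  (1 + β)α₀, (1 + β)α₁, α₀}. (3.16) This function has the bound |(3.15)| ≤ (1/r)E₀ exp(−κd_j(X)) ≤ … (3.17)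
  following from (3.9). Let us stress that it follows only from the fact that 𝐇_j(B(t)) satisfies (3.14) with
  1/3α₂, and δ𝐇_j satisfies (3.9)."  [cite: Balaban1987RG1, (3.15)–(3.17) p. 273]
Renders read (as images, this seat, for the three quotations above): CMP 109 p. 272 (PDF p. 24, ×2), CMP 109 p. 273
(PDF p. 25, ×2).
-/

noncomputable section

namespace Literature.MathematicalPhysics.QuantumFieldTheory.Balaban1983to89.T4DirectionChart

open NormedSpace Set Metric
open T4MeanLipschitzBirth (segScalar norm_segScalar)

/-! ## §1  Parallel transport by units, G-valued units, the base plaquette and the covariant sums [folklore] -/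

section Transport

variable {𝔸 : Type*} [NormedRing 𝔸]

/-- PARALLEL TRANSPORT (adjoint action) of an algebra element by a unit: `transport u A = u·A·u⁻¹`. [folklore] -/
def transport (u : 𝔸ˣ) (A : 𝔸) : 𝔸 := (u : 𝔸) * A * ((u⁻¹ : 𝔸ˣ) : 𝔸)

/-- `transport u A = u·A·u⁻¹`, unfolded. [folklore] -/
theorem transport_def (u : 𝔸ˣ) (A : 𝔸) : transport u A = (u : 𝔸) * A * ((u⁻¹ : 𝔸ˣ) : 𝔸) := rfl

/-- Transport by `1` is the identity. [folklore] -/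
@[simp] theorem transport_one (A : 𝔸) : transport 1 A = A := by simp [transport]

/-- Transport of `0` is `0`. [folklore] -/
@[simp] theorem transport_zero (u : 𝔸ˣ) : transport u 0 = 0 := by simp [transport]

/-- Transport is additive. [folklore] -/
theorem transport_add (u : 𝔸ˣ) (A B : 𝔸) : transport u (A + B) = transport u A + transport u B := by
  simp [transport, mul_add, add_mul]

/-- Transport commutes with negation. [folklore] -/
theorem transport_neg (u : 𝔸ˣ) (A : 𝔸) : transport u (-A) = -transport u A := by
  simp [transport, mul_neg, neg_mul]

/-- Transport is subtractive. [folklore] -/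
theorem transport_sub (u : 𝔸ˣ) (A B : 𝔸) : transport u (A - B) = transport u A - transport u B := by
  simp [transport, mul_sub, sub_mul]

/-- Transport along a product of units is the composite transport: `(uv)·A·(uv)⁻¹ = u·(v·A·v⁻¹)·u⁻¹`. [folklore] -/
theorem transport_mul (u v : 𝔸ˣ) (A : 𝔸) : transport (u * v) A = transport u (transport v A) := by
  simp [transport, mul_assoc]

/-- The displacement under transport, written out: `u·A·u⁻¹ − A = (u − 1)·A·u⁻¹ + A·(u⁻¹ − 1)`. [folklore] -/
theorem transport_sub_self (u : 𝔸ˣ) (A : 𝔸) :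
    transport u A - A = ((u : 𝔸) - 1) * A * ((u⁻¹ : 𝔸ˣ) : 𝔸) + A * (((u⁻¹ : 𝔸ˣ) : 𝔸) - 1) := by
  simp only [transport, sub_mul, one_mul, mul_sub, mul_one]
  abel

/-- Norm of a transported element: `‖u·A·u⁻¹‖ ≤ ‖u‖·‖A‖·‖u⁻¹‖`. [folklore] -/
theorem norm_transport_le_units (u : 𝔸ˣ) (A : 𝔸) :
    ‖transport u A‖ ≤ ‖(u : 𝔸)‖ * ‖A‖ * ‖((u⁻¹ : 𝔸ˣ) : 𝔸)‖ :=
  (norm_mul_le _ _).trans (mul_le_mul_of_nonneg_right (norm_mul_le _ _) (norm_nonneg _))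

/-- G-VALUED UNIT (the cell's dictionary for a bond variable with values in the compact group `G`, e.g. a unitary of
a C⋆-algebra): `u` and `u⁻¹` are contractions.  Motivating locus: the base of the printed chart (3.10) is the
G-valued lattice configuration `U_{k+1}`; nothing printed is asserted. [folklore] -/
def GUnit (u : 𝔸ˣ) : Prop := ‖(u : 𝔸)‖ ≤ 1 ∧ ‖((u⁻¹ : 𝔸ˣ) : 𝔸)‖ ≤ 1

/-- The inverse of a G-valued unit is G-valued. [folklore] -/
theorem GUnit.inv {u : 𝔸ˣ} (h : GUnit u) : GUnit u⁻¹ :=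
  ⟨h.2, by rw [inv_inv]; exact h.1⟩

/-- Products of G-valued units are G-valued. [folklore] -/
theorem GUnit.mul {u v : 𝔸ˣ} (hu : GUnit u) (hv : GUnit v) : GUnit (u * v) := by
  refine ⟨?_, ?_⟩
  · rw [Units.val_mul]
    calc ‖(u : 𝔸) * (v : 𝔸)‖ ≤ ‖(u : 𝔸)‖ * ‖(v : 𝔸)‖ := norm_mul_le _ _
      _ ≤ 1 * 1 := mul_le_mul hu.1 hv.1 (norm_nonneg _) zero_le_one
      _ = 1 := one_mul 1
  · rw [mul_inv_rev, Units.val_mul]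
    calc ‖((v⁻¹ : 𝔸ˣ) : 𝔸) * ((u⁻¹ : 𝔸ˣ) : 𝔸)‖ ≤ ‖((v⁻¹ : 𝔸ˣ) : 𝔸)‖ * ‖((u⁻¹ : 𝔸ˣ) : 𝔸)‖ :=
          norm_mul_le _ _
      _ ≤ 1 * 1 := mul_le_mul hv.2 hu.2 (norm_nonneg _) zero_le_one
      _ = 1 := one_mul 1

/-- Transport by a G-valued unit is norm-non-increasing ("isometric gauge transformations cost nothing"). [folklore] -/
theorem GUnit.norm_transport_le {u : 𝔸ˣ} (h : GUnit u) (A : 𝔸) : ‖transport u A‖ ≤ ‖A‖ := by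
  calc ‖transport u A‖ ≤ ‖(u : 𝔸)‖ * ‖A‖ * ‖((u⁻¹ : 𝔸ˣ) : 𝔸)‖ := norm_transport_le_units u A
    _ ≤ 1 * ‖A‖ * 1 :=
        mul_le_mul (mul_le_mul_of_nonneg_right h.1 (norm_nonneg _)) h.2 (norm_nonneg _)
          (mul_nonneg zero_le_one (norm_nonneg _))
    _ = ‖A‖ := by ring

/-- For a G-valued unit the inverse is as close to `1` as the unit: `‖u⁻¹ − 1‖ ≤ ‖u − 1‖`. [folklore] -/
theorem GUnit.norm_inv_sub_one_le {u : 𝔸ˣ} (h : GUnit u) : ‖((u⁻¹ : 𝔸ˣ) : 𝔸) - 1‖ ≤ ‖(u : 𝔸) - 1‖ := by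
  have he : ((u⁻¹ : 𝔸ˣ) : 𝔸) - 1 = ((u⁻¹ : 𝔸ˣ) : 𝔸) * (1 - (u : 𝔸)) := by
    rw [mul_sub, mul_one, Units.inv_mul]
  rw [he]
  calc ‖((u⁻¹ : 𝔸ˣ) : 𝔸) * (1 - (u : 𝔸))‖ ≤ ‖((u⁻¹ : 𝔸ˣ) : 𝔸)‖ * ‖1 - (u : 𝔸)‖ := norm_mul_le _ _
    _ ≤ 1 * ‖1 - (u : 𝔸)‖ := mul_le_mul_of_nonneg_right h.2 (norm_nonneg _)
    _ = ‖(u : 𝔸) - 1‖ := by rw [one_mul, norm_sub_rev]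

/-- Transport by a G-valued unit moves an element by at most twice the unit's distance to `1` times its size:
`‖u·A·u⁻¹ − A‖ ≤ 2‖u − 1‖·‖A‖`. [folklore] -/
theorem GUnit.norm_transport_sub_self_le {u : 𝔸ˣ} (h : GUnit u) (A : 𝔸) :
    ‖transport u A - A‖ ≤ 2 * ‖(u : 𝔸) - 1‖ * ‖A‖ := by
  rw [transport_sub_self]
  have h1 : ‖((u : 𝔸) - 1) * A * ((u⁻¹ : 𝔸ˣ) : 𝔸)‖ ≤ ‖(u : 𝔸) - 1‖ * ‖A‖ := by
    calc ‖((u : 𝔸) - 1) * A * ((u⁻¹ : 𝔸ˣ) : 𝔸)‖ ≤ ‖((u : 𝔸) - 1) * A‖ * ‖((u⁻¹ : 𝔸ˣ) : 𝔸)‖ := norm_mul_le _ _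
      _ ≤ ‖(u : 𝔸) - 1‖ * ‖A‖ * 1 := mul_le_mul (norm_mul_le _ _) h.2 (norm_nonneg _) (by positivity)
      _ = ‖(u : 𝔸) - 1‖ * ‖A‖ := mul_one _
  have h2 : ‖A * (((u⁻¹ : 𝔸ˣ) : 𝔸) - 1)‖ ≤ ‖A‖ * ‖(u : 𝔸) - 1‖ :=
    (norm_mul_le _ _).trans (mul_le_mul_of_nonneg_left h.norm_inv_sub_one_le (norm_nonneg _))
  calc _ ≤ ‖((u : 𝔸) - 1) * A * ((u⁻¹ : 𝔸ˣ) : 𝔸)‖ + ‖A * (((u⁻¹ : 𝔸ˣ) : 𝔸) - 1)‖ := norm_add_le _ _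
    _ ≤ ‖(u : 𝔸) - 1‖ * ‖A‖ + ‖A‖ * ‖(u : 𝔸) - 1‖ := add_le_add h1 h2
    _ = 2 * ‖(u : 𝔸) - 1‖ * ‖A‖ := by ring

/-- THE BASE PLAQUETTE VARIABLE (a unit): `basePlaq U₁ U₂ U₃ U₄ = U₁·U₂·U₃⁻¹·U₄⁻¹`, the plaquette of the base
configuration around the oriented plaquette with bond variables `U₁, U₂` (forward) and `U₃, U₄` (traversed
backwards). [folklore] -/
def basePlaq (U₁ U₂ U₃ U₄ : 𝔸ˣ) : 𝔸ˣ := U₁ * U₂ * U₃⁻¹ * U₄⁻¹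

/-- The base plaquette variable, as an algebra element. [folklore] -/
theorem val_basePlaq (U₁ U₂ U₃ U₄ : 𝔸ˣ) :
    ((basePlaq U₁ U₂ U₃ U₄ : 𝔸ˣ) : 𝔸) = (U₁ : 𝔸) * (U₂ : 𝔸) * ((U₃⁻¹ : 𝔸ˣ) : 𝔸) * ((U₄⁻¹ : 𝔸ˣ) : 𝔸) := by
  simp [basePlaq]

/-- A plaquette of G-valued bond variables is G-valued. [folklore] -/
theorem GUnit.basePlaq {U₁ U₂ U₃ U₄ : 𝔸ˣ} (h₁ : GUnit U₁) (h₂ : GUnit U₂) (h₃ : GUnit U₃) (h₄ : GUnit U₄) :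
    GUnit (basePlaq U₁ U₂ U₃ U₄) :=
  ((h₁.mul h₂).mul h₃.inv).mul h₄.inv

/-- The open path `W = U₁U₂U₃⁻¹` (three sides of the plaquette) of G-valued bond variables is G-valued. [folklore] -/
theorem GUnit.path₃ {U₁ U₂ U₃ : 𝔸ˣ} (h₁ : GUnit U₁) (h₂ : GUnit U₂) (h₃ : GUnit U₃) :
    GUnit (U₁ * U₂ * U₃⁻¹) :=
  (h₁.mul h₂).mul h₃.inv

/-- THE COVARIANT PLAQUETTE SUM of a direction `A` over the base `U`: the oriented sum of the four potentials
PARALLEL-TRANSPORTED TO THE PLAQUETTE'S BASE POINT along its boundary,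
`A₁ + U₁A₂U₁⁻¹ − W·A₃·W⁻¹ − P₀·A₄·P₀⁻¹` (`W = U₁U₂U₃⁻¹`, `P₀ = basePlaq`).  In the cell's dictionary this is `ξ`
times two COVARIANT difference quotients `∇^ξ_U𝐀` of the direction (the third member of the printed window (3.14)),
up to conjugations by the base plaquette variable (`norm_covSum_sub_covSum'_le`); it is the first-order term of the
moved plaquette (`movedPlaq_eq` with `T4SegmentCurvature.norm_hol_sub_one_le`).  Nothing printed is asserted.
[cite: Balaban1987RG1, (3.14) p. 272] -/
def covSum (U₁ U₂ U₃ U₄ : 𝔸ˣ) (A₁ A₂ A₃ A₄ : 𝔸) : 𝔸 :=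
  A₁ + transport U₁ A₂ - transport (U₁ * U₂ * U₃⁻¹) A₃ - transport (basePlaq U₁ U₂ U₃ U₄) A₄

/-- The EXACTLY COVARIANT variant: `A₁ + U₁A₂U₁⁻¹ − U₄A₃U₄⁻¹ − A₄` — with the plaquette at `x` in the `μν`-plane and
`∇^U_μ f(x) := ξ⁻¹(U(x, x+μ)·f(x+μ)·U(x, x+μ)⁻¹ − f(x))` this is `ξ·[(∇^U_μ A_ν)(x) − (∇^U_ν A_μ)(x)]` (the cell's
dictionary; nothing printed is asserted). [cite: Balaban1987RG1, (3.14) p. 272] -/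
def covSum' (U₁ U₄ : 𝔸ˣ) (A₁ A₂ A₃ A₄ : 𝔸) : 𝔸 :=
  A₁ + transport U₁ A₂ - transport U₄ A₃ - A₄

/-- The three-sided path is the base plaquette followed by the fourth bond: `U₁U₂U₃⁻¹ = P₀·U₄`. [folklore] -/
theorem path₃_eq_basePlaq_mul (U₁ U₂ U₃ U₄ : 𝔸ˣ) : U₁ * U₂ * U₃⁻¹ = basePlaq U₁ U₂ U₃ U₄ * U₄ := by
  simp [basePlaq]

/-- THE TWO DICTIONARIES AGREE UP TO THE BASE CURVATURE: for a G-valued base,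
`‖covSum − covSum'‖ ≤ 2‖P₀ − 1‖·(‖A₃‖ + ‖A₄‖)` — the transports to the base point along the two halves of the boundary
differ by a conjugation with the base plaquette variable `P₀`. [folklore] -/
theorem norm_covSum_sub_covSum'_le {U₁ U₂ U₃ U₄ : 𝔸ˣ} (h₁ : GUnit U₁) (h₂ : GUnit U₂) (h₃ : GUnit U₃)
    (h₄ : GUnit U₄) (A₁ A₂ A₃ A₄ : 𝔸) :
    ‖covSum U₁ U₂ U₃ U₄ A₁ A₂ A₃ A₄ - covSum' U₁ U₄ A₁ A₂ A₃ A₄‖ ≤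
      2 * ‖((basePlaq U₁ U₂ U₃ U₄ : 𝔸ˣ) : 𝔸) - 1‖ * (‖A₃‖ + ‖A₄‖) := by
  have hP : GUnit (basePlaq U₁ U₂ U₃ U₄) := h₁.basePlaq h₂ h₃ h₄
  have hdiff : covSum U₁ U₂ U₃ U₄ A₁ A₂ A₃ A₄ - covSum' U₁ U₄ A₁ A₂ A₃ A₄ =
      -(transport (basePlaq U₁ U₂ U₃ U₄) (transport U₄ A₃) - transport U₄ A₃) -
        (transport (basePlaq U₁ U₂ U₃ U₄) A₄ - A₄) := by
    rw [covSum, covSum', path₃_eq_basePlaq_mul U₁ U₂ U₃ U₄, transport_mul]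
    abel
  rw [hdiff]
  have e₃ := hP.norm_transport_sub_self_le (transport U₄ A₃)
  have e₄ := hP.norm_transport_sub_self_le A₄
  have n₃ : ‖transport U₄ A₃‖ ≤ ‖A₃‖ := h₄.norm_transport_le A₃
  have h0 : 0 ≤ 2 * ‖((basePlaq U₁ U₂ U₃ U₄ : 𝔸ˣ) : 𝔸) - 1‖ := by positivity
  calc _ ≤ ‖-(transport (basePlaq U₁ U₂ U₃ U₄) (transport U₄ A₃) - transport U₄ A₃)‖ +
        ‖transport (basePlaq U₁ U₂ U₃ U₄) A₄ - A₄‖ := norm_sub_le _ _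
    _ ≤ 2 * ‖((basePlaq U₁ U₂ U₃ U₄ : 𝔸ˣ) : 𝔸) - 1‖ * ‖transport U₄ A₃‖ +
        2 * ‖((basePlaq U₁ U₂ U₃ U₄ : 𝔸ˣ) : 𝔸) - 1‖ * ‖A₄‖ := by rw [norm_neg]; exact add_le_add e₃ e₄
    _ ≤ 2 * ‖((basePlaq U₁ U₂ U₃ U₄ : 𝔸ˣ) : 𝔸) - 1‖ * ‖A₃‖ +
        2 * ‖((basePlaq U₁ U₂ U₃ U₄ : 𝔸ˣ) : 𝔸) - 1‖ * ‖A₄‖ := by gcongr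
    _ = 2 * ‖((basePlaq U₁ U₂ U₃ U₄ : 𝔸ˣ) : 𝔸) - 1‖ * (‖A₃‖ + ‖A₄‖) := by ring

end Transport

/-! ## §2  The moved configuration `exp(c·A)·U` and the covariant transport identity [folklore] -/

section Moved

variable {𝔸 : Type*} [NormedRing 𝔸] [NormedAlgebra ℂ 𝔸]

/-- Transport is `ℂ`-linear: `u·(c•A)·u⁻¹ = c•(u·A·u⁻¹)`. [folklore] -/
theorem transport_smul (u : 𝔸ˣ) (c : ℂ) (A : 𝔸) : transport u (c • A) = c • transport u A := by
  simp only [transport, mul_smul_comm, smul_mul_assoc]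

variable [CompleteSpace 𝔸]

/-- The exponential commutes with transport: `exp(u·X·u⁻¹) = u·exp X·u⁻¹` (Mathlib `NormedSpace.exp_units_conj`; the
rational-algebra structure it is stated over is the restriction of scalars from `ℂ`). [folklore] -/
theorem exp_transport (u : 𝔸ˣ) (X : 𝔸) : exp (transport u X) = (u : 𝔸) * exp X * ((u⁻¹ : 𝔸ˣ) : 𝔸) := by
  letI : NormedAlgebra ℚ 𝔸 := NormedAlgebra.restrictScalars ℚ ℂ 𝔸
  exact exp_units_conj u X

omit [CompleteSpace 𝔸] in
/-- THE PLAQUETTE VARIABLE OF THE MOVED CONFIGURATION `b ↦ exp(c·A(b))·U(b)` around the oriented plaquette with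
forward bonds `1, 2` and backward bonds `3, 4` (a backward bond carries the inverse bond variable
`U(b)⁻¹·exp(−c·A(b))`, `bond_mul_bondInv`): `exp(cA₁)U₁ · exp(cA₂)U₂ · U₃⁻¹exp(−cA₃) · U₄⁻¹exp(−cA₄)`.  Intended
reading (the cell's): `c = iξs`, `U` = the base `U₀` of the printed chart `𝐔′ = exp iξ𝐀U_{k+1}`, `A` = the
direction; nothing printed is asserted. [cite: Balaban1987RG1, (3.10) p. 272] -/
def movedPlaq (c : ℂ) (U₁ U₂ U₃ U₄ : 𝔸ˣ) (A₁ A₂ A₃ A₄ : 𝔸) : 𝔸 :=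
  exp (c • A₁) * (U₁ : 𝔸) * (exp (c • A₂) * (U₂ : 𝔸)) * (((U₃⁻¹ : 𝔸ˣ) : 𝔸) * exp (-(c • A₃))) *
    (((U₄⁻¹ : 𝔸ˣ) : 𝔸) * exp (-(c • A₄)))

/-- The backward bond variable is the right inverse of the forward one: `exp(cA)U · U⁻¹exp(−cA) = 1`. [folklore] -/
theorem bond_mul_bondInv (c : ℂ) (U : 𝔸ˣ) (A : 𝔸) :
    exp (c • A) * (U : 𝔸) * (((U⁻¹ : 𝔸ˣ) : 𝔸) * exp (-(c • A))) = 1 := by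
  letI : NormedAlgebra ℝ 𝔸 := NormedAlgebra.restrictScalars ℝ ℂ 𝔸
  rw [mul_assoc, ← mul_assoc (U : 𝔸), Units.mul_inv, one_mul, Literature.Analysis.Calculus.exp_mul_exp_neg]

/-- … and the left inverse: `U⁻¹exp(−cA) · exp(cA)U = 1`. [folklore] -/
theorem bondInv_mul_bond (c : ℂ) (U : 𝔸ˣ) (A : 𝔸) :
    ((U⁻¹ : 𝔸ˣ) : 𝔸) * exp (-(c • A)) * (exp (c • A) * (U : 𝔸)) = 1 := by
  letI : NormedAlgebra ℝ 𝔸 := NormedAlgebra.restrictScalars ℝ ℂ 𝔸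
  rw [mul_assoc, ← mul_assoc (exp _), Literature.Analysis.Calculus.exp_neg_mul_exp, one_mul, Units.inv_mul]

omit [CompleteSpace 𝔸] in
/-- With a vanishing direction the moved plaquette is the base plaquette. [folklore] -/
theorem movedPlaq_zero_dir (c : ℂ) (U₁ U₂ U₃ U₄ : 𝔸ˣ) :
    movedPlaq c U₁ U₂ U₃ U₄ 0 0 0 0 = ((basePlaq U₁ U₂ U₃ U₄ : 𝔸ˣ) : 𝔸) := by
  simp [movedPlaq, basePlaq, mul_assoc]

/-- THE COVARIANT TRANSPORT IDENTITY.  The moved plaquette equals the PURE-POTENTIAL plaquette of the transported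
potentials `Ã₁ = A₁`, `Ã₂ = U₁A₂U₁⁻¹`, `Ã₃ = W·A₃·W⁻¹` (`W = U₁U₂U₃⁻¹`), `Ã₄ = P₀·A₄·P₀⁻¹`, TIMES the base
plaquette variable `P₀`:
`movedPlaq c U A = exp(cÃ₁)·exp(cÃ₂)·exp(−cÃ₃)·exp(−cÃ₄)·P₀` — the first factor is literally the written-out
product of `T4SegmentCurvature` §2, so every lemma there applies to it. [folklore] -/
theorem movedPlaq_eq (c : ℂ) (U₁ U₂ U₃ U₄ : 𝔸ˣ) (A₁ A₂ A₃ A₄ : 𝔸) :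
    movedPlaq c U₁ U₂ U₃ U₄ A₁ A₂ A₃ A₄ =
      exp (c • A₁) * exp (c • transport U₁ A₂) * exp (-(c • transport (U₁ * U₂ * U₃⁻¹) A₃)) *
          exp (-(c • transport (basePlaq U₁ U₂ U₃ U₄) A₄)) * ((basePlaq U₁ U₂ U₃ U₄ : 𝔸ˣ) : 𝔸) := by
  rw [← transport_smul, ← transport_smul, ← transport_smul, ← transport_neg, ← transport_neg, exp_transport,
    exp_transport, exp_transport]
  simp only [movedPlaq, basePlaq, Units.val_mul, mul_inv_rev, inv_inv, mul_assoc, Units.inv_mul_cancel_left,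
    Units.mul_inv_cancel_left, Units.mul_inv, mul_one]

/-- THE MOVED PLAQUETTE FROM THE PURE-POTENTIAL ONE AND THE BASE: for a contractive base plaquette variable,
`‖movedPlaq − 1‖ ≤ ‖exp(cÃ₁)exp(cÃ₂)exp(−cÃ₃)exp(−cÃ₄) − 1‖ + ‖P₀ − 1‖`
(`T4AxialChain.norm_mul_sub_one_le_add'`). [folklore] -/
theorem norm_movedPlaq_sub_one_le (c : ℂ) (U₁ U₂ U₃ U₄ : 𝔸ˣ) (A₁ A₂ A₃ A₄ : 𝔸)
    (hP : ‖((basePlaq U₁ U₂ U₃ U₄ : 𝔸ˣ) : 𝔸)‖ ≤ 1) :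
    ‖movedPlaq c U₁ U₂ U₃ U₄ A₁ A₂ A₃ A₄ - 1‖ ≤
      ‖exp (c • A₁) * exp (c • transport U₁ A₂) * exp (-(c • transport (U₁ * U₂ * U₃⁻¹) A₃)) *
          exp (-(c • transport (basePlaq U₁ U₂ U₃ U₄) A₄)) - 1‖ + ‖((basePlaq U₁ U₂ U₃ U₄ : 𝔸ˣ) : 𝔸) - 1‖ := by
  rw [movedPlaq_eq]
  exact T4AxialChain.norm_mul_sub_one_le_add' _ hP

/-- IN CURVATURE UNITS [bookkeeping over the dictionary of the header]: `‖c‖ = ξσ`, transported potentials `≤ a`,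
covariant plaquette sum `‖covSum‖ ≤ 2ξa′`, `4ξσa ≤ 1`, contractive base plaquette with `‖P₀ − 1‖ ≤ δ_b ξ²`; then
`‖movedPlaq − 1‖ ≤ ξ²·(δ_b + 2σa′ + 16σ²a²)` — the sibling's `O(ξ²)` bound plus the base curvature
(`T4SegmentCurvature.norm_hol_sub_one_le_xi_sq` applied to the transported potentials). [folklore] -/
theorem norm_movedPlaq_sub_one_le_xi_sq (c : ℂ) (U₁ U₂ U₃ U₄ : 𝔸ˣ) (A₁ A₂ A₃ A₄ : 𝔸) {ξ σ a a' δb : ℝ}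
    (hξ : 0 ≤ ξ) (hσ : 0 ≤ σ) (hc : ‖c‖ = ξ * σ) (hP : ‖((basePlaq U₁ U₂ U₃ U₄ : 𝔸ˣ) : 𝔸)‖ ≤ 1)
    (hPδ : ‖((basePlaq U₁ U₂ U₃ U₄ : 𝔸ˣ) : 𝔸) - 1‖ ≤ δb * ξ ^ 2) (h₁ : ‖A₁‖ ≤ a)
    (h₂ : ‖transport U₁ A₂‖ ≤ a) (h₃ : ‖transport (U₁ * U₂ * U₃⁻¹) A₃‖ ≤ a)
    (h₄ : ‖transport (basePlaq U₁ U₂ U₃ U₄) A₄‖ ≤ a) (hcov : ‖covSum U₁ U₂ U₃ U₄ A₁ A₂ A₃ A₄‖ ≤ 2 * ξ * a')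
    (hT : 4 * ξ * σ * a ≤ 1) :
    ‖movedPlaq c U₁ U₂ U₃ U₄ A₁ A₂ A₃ A₄ - 1‖ ≤ ξ ^ 2 * (δb + 2 * σ * a' + 16 * σ ^ 2 * a ^ 2) := by
  have hcov' : ‖A₁ + transport U₁ A₂ - transport (U₁ * U₂ * U₃⁻¹) A₃ - transport (basePlaq U₁ U₂ U₃ U₄) A₄‖ ≤
      2 * ξ * a' := hcov
  have h := T4SegmentCurvature.norm_hol_sub_one_le_xi_sq (𝕂 := ℂ) c A₁ (transport U₁ A₂)
    (transport (U₁ * U₂ * U₃⁻¹) A₃) (transport (basePlaq U₁ U₂ U₃ U₄) A₄) hξ hσ hc h₁ h₂ h₃ h₄ hcov' hT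
  calc _ ≤ _ := norm_movedPlaq_sub_one_le c U₁ U₂ U₃ U₄ A₁ A₂ A₃ A₄ hP
    _ ≤ ξ ^ 2 * (2 * σ * a' + 16 * σ ^ 2 * a ^ 2) + δb * ξ ^ 2 := add_le_add h hPδ
    _ = ξ ^ 2 * (δb + 2 * σ * a' + 16 * σ ^ 2 * a ^ 2) := by ring

end Moved

/-! ## §3  The direction window and the chart condition [bookkeeping] -/

section Window

/-- THE CHART CONDITION (= `T4SegmentCurvature.segment_condition` at HALF the curvature constant): with gauges
`a, a′ ≤ dev`, thickening `α₁′ ≥ 0`, `dev + α₁′ ≤ α₀/8` and `α₀ ≤ 1`, every excursion `σ ≤ 1 + α₁′/dev` gives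
`2σa′ + 16σ²a² ≤ α₀/2` and `4σa ≤ α₀/2` — the direction's share of the curvature budget, the other half being the
base's. [folklore] -/
theorem chart_condition {α₀ α₁' dev σ a a' : ℝ} (hα₀ : α₀ ≤ 1) (hdev : 0 < dev) (hα₁ : 0 ≤ α₁')
    (hsum : dev + α₁' ≤ α₀ / 8) (hσ0 : 0 ≤ σ) (hσ : σ ≤ 1 + α₁' / dev) (ha0 : 0 ≤ a) (ha : a ≤ dev)
    (ha'0 : 0 ≤ a') (ha' : a' ≤ dev) :
    2 * σ * a' + 16 * σ ^ 2 * a ^ 2 ≤ α₀ / 2 ∧ 4 * σ * a ≤ α₀ / 2 :=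
  T4SegmentCurvature.segment_condition (α₀ := α₀ / 2) (by linarith) hdev hα₁ (by linarith) hσ0 hσ ha0 ha ha'0 ha'

variable {𝔸 : Type*} [NormedRing 𝔸] [NormedAlgebra ℂ 𝔸] [CompleteSpace 𝔸]

/-- THE MOVED PLAQUETTE OVER THE WHOLE FAMILY OF DISCS: under the chart condition (`dev + α₁′ ≤ α₀/8`, `α₀ ≤ 1`,
`ξ ≤ 1`), a contractive base plaquette inside HALF the curvature domain (`‖P₀ − 1‖ ≤ δ_bξ²`, `δ_b ≤ α₀/2`),
transported potentials `≤ a ≤ dev` and covariant plaquette sum `≤ 2ξa′`, `a′ ≤ dev`, every scalar `‖c‖ = ξσ` with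
`σ ≤ 1 + α₁′/dev` gives `‖movedPlaq c − 1‖ ≤ α₀·ξ²` — the shape of the curvature clauses (1.11)/(1.14) for the moved
configuration, in the header's dictionary. [folklore] -/
theorem norm_movedPlaq_sub_one_le_of_condition (c : ℂ) (U₁ U₂ U₃ U₄ : 𝔸ˣ) (A₁ A₂ A₃ A₄ : 𝔸)
    {ξ σ a a' α₀ α₁' dev δb : ℝ} (hξ0 : 0 ≤ ξ) (hξ1 : ξ ≤ 1) (hα₀ : α₀ ≤ 1) (hdev : 0 < dev) (hα₁ : 0 ≤ α₁')
    (hsum : dev + α₁' ≤ α₀ / 8) (hσ0 : 0 ≤ σ) (hσ : σ ≤ 1 + α₁' / dev) (hc : ‖c‖ = ξ * σ) (ha0 : 0 ≤ a)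
    (ha : a ≤ dev) (ha'0 : 0 ≤ a') (ha' : a' ≤ dev) (hP : ‖((basePlaq U₁ U₂ U₃ U₄ : 𝔸ˣ) : 𝔸)‖ ≤ 1)
    (hPδ : ‖((basePlaq U₁ U₂ U₃ U₄ : 𝔸ˣ) : 𝔸) - 1‖ ≤ δb * ξ ^ 2) (hδb : δb ≤ α₀ / 2) (h₁ : ‖A₁‖ ≤ a)
    (h₂ : ‖transport U₁ A₂‖ ≤ a) (h₃ : ‖transport (U₁ * U₂ * U₃⁻¹) A₃‖ ≤ a)
    (h₄ : ‖transport (basePlaq U₁ U₂ U₃ U₄) A₄‖ ≤ a) (hcov : ‖covSum U₁ U₂ U₃ U₄ A₁ A₂ A₃ A₄‖ ≤ 2 * ξ * a') :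
    ‖movedPlaq c U₁ U₂ U₃ U₄ A₁ A₂ A₃ A₄ - 1‖ ≤ α₀ * ξ ^ 2 := by
  obtain ⟨hcoef, h4⟩ := chart_condition hα₀ hdev hα₁ hsum hσ0 hσ ha0 ha ha'0 ha'
  have hT : 4 * ξ * σ * a ≤ 1 := by
    have h0 : 0 ≤ 4 * σ * a := by positivity
    nlinarith
  calc ‖movedPlaq c U₁ U₂ U₃ U₄ A₁ A₂ A₃ A₄ - 1‖ ≤ ξ ^ 2 * (δb + 2 * σ * a' + 16 * σ ^ 2 * a ^ 2) :=
        norm_movedPlaq_sub_one_le_xi_sq c U₁ U₂ U₃ U₄ A₁ A₂ A₃ A₄ hξ0 hσ0 hc hP hPδ h₁ h₂ h₃ h₄ hcov hT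
    _ ≤ ξ ^ 2 * α₀ := mul_le_mul_of_nonneg_left (by linarith) (sq_nonneg ξ)
    _ = α₀ * ξ ^ 2 := mul_comm _ _

/-- THE DIRECTION WINDOW (the SHAPE of the printed "there exists a constant α₂, depending on α₀ and on some absolute
constants", for the curvature clause only, with the cell's explicit `α₂ = α₀/8`): a contractive base plaquette inside
HALF the curvature domain (`‖P₀ − 1‖ ≤ δ_bξ²`, `δ_b ≤ α₀/2`; cf. the printed base space `U^c_j(X, ½α₀, ½α₁, α₀)`)
and a direction in the window — transported potentials `≤ α₂` and covariant plaquette sum `≤ 2ξα₂` with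
`α₂ ≤ α₀/8` — give `‖movedPlaq c − 1‖ ≤ α₀ξ²` for EVERY complex coefficient `‖c‖ ≤ ξ` (`0 < ξ ≤ 1`,
`0 < α₀ ≤ 1`).  Nothing printed is asserted. [folklore] -/
theorem norm_movedPlaq_sub_one_le_of_window (c : ℂ) (U₁ U₂ U₃ U₄ : 𝔸ˣ) (A₁ A₂ A₃ A₄ : 𝔸) {ξ α₀ α₂ δb : ℝ}
    (hξ0 : 0 < ξ) (hξ1 : ξ ≤ 1) (hα₀0 : 0 < α₀) (hα₀ : α₀ ≤ 1) (hα₂0 : 0 ≤ α₂) (hα₂ : α₂ ≤ α₀ / 8)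
    (hc : ‖c‖ ≤ ξ) (hP : ‖((basePlaq U₁ U₂ U₃ U₄ : 𝔸ˣ) : 𝔸)‖ ≤ 1)
    (hPδ : ‖((basePlaq U₁ U₂ U₃ U₄ : 𝔸ˣ) : 𝔸) - 1‖ ≤ δb * ξ ^ 2) (hδb : δb ≤ α₀ / 2) (h₁ : ‖A₁‖ ≤ α₂)
    (h₂ : ‖transport U₁ A₂‖ ≤ α₂) (h₃ : ‖transport (U₁ * U₂ * U₃⁻¹) A₃‖ ≤ α₂)
    (h₄ : ‖transport (basePlaq U₁ U₂ U₃ U₄) A₄‖ ≤ α₂) (hcov : ‖covSum U₁ U₂ U₃ U₄ A₁ A₂ A₃ A₄‖ ≤ 2 * ξ * α₂) :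
    ‖movedPlaq c U₁ U₂ U₃ U₄ A₁ A₂ A₃ A₄ - 1‖ ≤ α₀ * ξ ^ 2 := by
  have hdev : (0 : ℝ) < α₀ / 8 := by positivity
  have hσ0 : 0 ≤ ‖c‖ / ξ := div_nonneg (norm_nonneg _) hξ0.le
  have hσ1 : ‖c‖ / ξ ≤ 1 + 0 / (α₀ / 8) := by
    rw [zero_div, add_zero]; exact (div_le_one hξ0).mpr hc
  have hcξ : ‖c‖ = ξ * (‖c‖ / ξ) := by field_simp
  exact norm_movedPlaq_sub_one_le_of_condition c U₁ U₂ U₃ U₄ A₁ A₂ A₃ A₄ hξ0.le hξ1 hα₀ hdev le_rfl (by linarith)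
    hσ0 hσ1 hcξ hα₂0 hα₂ hα₂0 hα₂ hP hPδ hδb h₁ h₂ h₃ h₄ hcov

end Window

/-! ## §4  The tube of the chart and the disc inclusion [bookkeeping] -/

section Tube

variable {ι : Type*} {𝔸 : Type*} [NormedRing 𝔸] [NormedAlgebra ℂ 𝔸]

/-- The BASE CONFIGURATION as a link configuration: bond `i` carries `U i`. [folklore] -/
def baseConfig (U : ι → 𝔸ˣ) : ι → 𝔸 := fun i => (U i : 𝔸)

/-- The base plaquette variable around the oriented plaquette `p = (i₁, i₂, i₃, i₄)`. [folklore] -/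
def basePlaqAt (U : ι → 𝔸ˣ) (p : ι × ι × ι × ι) : 𝔸ˣ := basePlaq (U p.1) (U p.2.1) (U p.2.2.1) (U p.2.2.2)

/-- The covariant plaquette sum of the direction `A` over the base `U` around `p`. [folklore] -/
def covSumAt (A : ι → 𝔸) (U : ι → 𝔸ˣ) (p : ι × ι × ι × ι) : 𝔸 :=
  covSum (U p.1) (U p.2.1) (U p.2.2.1) (U p.2.2.2) (A p.1) (A p.2.1) (A p.2.2.1) (A p.2.2.2)

/-- The plaquette variable of the moved configuration `i ↦ exp(c·A i)·U i` around `p`. [folklore] -/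
def dirPlaq (c : ℂ) (A : ι → 𝔸) (U : ι → 𝔸ˣ) (p : ι × ι × ι × ι) : 𝔸 :=
  movedPlaq c (U p.1) (U p.2.1) (U p.2.2.1) (U p.2.2.2) (A p.1) (A p.2.1) (A p.2.2.1) (A p.2.2.2)

/-- THE TUBE OF THE CHART (the cell's plaquette-level MODEL of the small-field clauses for the moved configuration
`exp(iξs𝐀)U₀ = exp(iξ·i(Im s)𝐀)·(exp(iξ(Re s)𝐀)U₀)`; NOT a printed space): the complex parameters `s` with
(C1) `|Im s|·N ≤ α₁′`, (C2) `|Re s|·N ≤ t`, (C3) `‖dirPlaq (iξs) A U p − 1‖ ≤ α₀ξ²` on `plaq`, (C4) the same at the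
real scalar `iξ·Re s`.  The printed clauses are the LOCUS MODELLED; nothing printed is asserted.
[cite: Balaban1987RG1, (1.11)–(1.14) p. 262] -/
def dirTube (ξ α₀ α₁' t : ℝ) (plaq : Set (ι × ι × ι × ι)) (A : ι → 𝔸) (U : ι → 𝔸ˣ) (N : ℝ) : Set ℂ :=
  {s | |s.im| * N ≤ α₁' ∧ |s.re| * N ≤ t ∧
    (∀ p ∈ plaq, ‖dirPlaq (segScalar ξ s) A U p - 1‖ ≤ α₀ * ξ ^ 2) ∧
    ∀ p ∈ plaq, ‖dirPlaq (segScalar ξ (s.re : ℂ)) A U p - 1‖ ≤ α₀ * ξ ^ 2}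

/-- Membership in the tube, unfolded (the four clauses (C1)–(C4)). [folklore] -/
theorem mem_dirTube {ξ α₀ α₁' t : ℝ} {plaq : Set (ι × ι × ι × ι)} {A : ι → 𝔸} {U : ι → 𝔸ˣ} {N : ℝ} {s : ℂ} :
    s ∈ dirTube ξ α₀ α₁' t plaq A U N ↔ |s.im| * N ≤ α₁' ∧ |s.re| * N ≤ t ∧
      (∀ p ∈ plaq, ‖dirPlaq (segScalar ξ s) A U p - 1‖ ≤ α₀ * ξ ^ 2) ∧
      ∀ p ∈ plaq, ‖dirPlaq (segScalar ξ (s.re : ℂ)) A U p - 1‖ ≤ α₀ * ξ ^ 2 :=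
  Iff.rfl

variable [CompleteSpace 𝔸]

/-- The curvature clause of the tube at one scalar, from the chart condition (the two uses (C3)/(C4) below).
[folklore] -/
theorem norm_dirPlaq_sub_one_le {ξ α₀ α₁' dev N δb : ℝ} {plaq : Set (ι × ι × ι × ι)} {A : ι → 𝔸} {U : ι → 𝔸ˣ}
    (hξ0 : 0 < ξ) (hξ1 : ξ ≤ 1) (hα₀ : α₀ ≤ 1) (hα₁ : 0 ≤ α₁') (hdev : 0 < dev) (hN0 : 0 ≤ N) (hN : N ≤ dev)
    (hU : ∀ i, GUnit (U i)) (hA : ∀ i, ‖A i‖ ≤ N)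
    (hbase : ∀ p ∈ plaq, ‖((basePlaqAt U p : 𝔸ˣ) : 𝔸) - 1‖ ≤ δb * ξ ^ 2) (hδb : δb ≤ α₀ / 2)
    (hcov : ∀ p ∈ plaq, ‖covSumAt A U p‖ ≤ 2 * ξ * N) (hsum : dev + α₁' ≤ α₀ / 8)
    {c : ℂ} (hσ : ‖c‖ ≤ 1 + α₁' / dev) {p : ι × ι × ι × ι} (hp : p ∈ plaq) :
    ‖dirPlaq (segScalar ξ c) A U p - 1‖ ≤ α₀ * ξ ^ 2 := by
  have hP : GUnit (basePlaqAt U p) := (hU _).basePlaq (hU _) (hU _) (hU _)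
  have hW : GUnit (U p.1 * U p.2.1 * (U p.2.2.1)⁻¹) := (hU _).path₃ (hU _) (hU _)
  exact norm_movedPlaq_sub_one_le_of_condition (segScalar ξ c) (U p.1) (U p.2.1) (U p.2.2.1) (U p.2.2.2)
    (A p.1) (A p.2.1) (A p.2.2.1) (A p.2.2.2) hξ0.le hξ1 hα₀ hdev hα₁ hsum (norm_nonneg c) hσ
    (norm_segScalar hξ0.le c) hN0 hN hN0 hN hP.1 (hbase p hp) hδb (hA _)
    (((hU _).norm_transport_le _).trans (hA _)) ((hW.norm_transport_le _).trans (hA _))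
    ((hP.norm_transport_le _).trans (hA _)) (hcov p hp)

/-- THE DISC INCLUSION (the hypothesis `hseg`'s last clause in `T4AxialChain.meanLipschitz_of_segment`, DISCHARGED
into the tube of the chart): with a G-valued base of curvature `≤ δ_bξ²` on `plaq`, `δ_b ≤ α₀/2`, a direction with
`‖A i‖ ≤ N ≤ dev`, `0 < dev`, covariant plaquette sums `≤ 2ξN` on `plaq`, the chart condition `dev + α₁′ ≤ α₀/8`,
`α₀ ≤ 1`, `0 < ξ ≤ 1` and `dev + α₁′ ≤ t`, every closed disc of radius `α₁′/dev` about a point of `[0, 1]` lies in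
the tube — (C1) from `|Im s| ≤ α₁′/dev`, (C2) from `|Re s| ≤ |s| ≤ 1 + α₁′/dev`
(`T4SegmentCurvature.norm_le_one_add_of_mem_closedBall`), (C3)/(C4) from §3 at the excursions `σ = |s|` and
`σ = |Re s|`. [folklore] -/
theorem closedBall_subset_dirTube {ξ α₀ α₁' t dev N δb : ℝ} {plaq : Set (ι × ι × ι × ι)} {A : ι → 𝔸}
    {U : ι → 𝔸ˣ} (hξ0 : 0 < ξ) (hξ1 : ξ ≤ 1) (hα₀ : α₀ ≤ 1) (hα₁ : 0 ≤ α₁') (hdev : 0 < dev) (hN0 : 0 ≤ N)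
    (hN : N ≤ dev) (hU : ∀ i, GUnit (U i)) (hA : ∀ i, ‖A i‖ ≤ N)
    (hbase : ∀ p ∈ plaq, ‖((basePlaqAt U p : 𝔸ˣ) : 𝔸) - 1‖ ≤ δb * ξ ^ 2) (hδb : δb ≤ α₀ / 2)
    (hcov : ∀ p ∈ plaq, ‖covSumAt A U p‖ ≤ 2 * ξ * N) (hsum : dev + α₁' ≤ α₀ / 8) (ht : dev + α₁' ≤ t)
    {s₀ : ℝ} (hs₀ : s₀ ∈ Icc (0 : ℝ) 1) :
    closedBall (s₀ : ℂ) (α₁' / dev) ⊆ dirTube ξ α₀ α₁' t plaq A U N := by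
  intro s hs
  have hϱ : ‖s‖ ≤ 1 + α₁' / dev := T4SegmentCurvature.norm_le_one_add_of_mem_closedBall hs₀ hs
  have hdist : ‖s - (s₀ : ℂ)‖ ≤ α₁' / dev := by rwa [mem_closedBall, dist_eq_norm] at hs
  have him : |s.im| ≤ α₁' / dev := by
    have h1 : |(s - (s₀ : ℂ)).im| ≤ ‖s - (s₀ : ℂ)‖ := Complex.abs_im_le_norm _
    have h2 : (s - (s₀ : ℂ)).im = s.im := by simp
    rw [h2] at h1
    exact h1.trans hdist
  have hre : |s.re| ≤ 1 + α₁' / dev := (Complex.abs_re_le_norm s).trans hϱ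
  have hϱ0 : 0 ≤ α₁' / dev := div_nonneg hα₁ hdev.le
  refine ⟨?_, ?_, ?_, ?_⟩
  · calc |s.im| * N ≤ α₁' / dev * N := mul_le_mul_of_nonneg_right him hN0
      _ ≤ α₁' / dev * dev := mul_le_mul_of_nonneg_left hN hϱ0
      _ = α₁' := div_mul_cancel₀ α₁' hdev.ne'
  · calc |s.re| * N ≤ (1 + α₁' / dev) * N := mul_le_mul_of_nonneg_right hre hN0
      _ ≤ (1 + α₁' / dev) * dev := mul_le_mul_of_nonneg_left hN (by linarith)
      _ = dev + α₁' := by rw [add_mul, one_mul, div_mul_cancel₀ α₁' hdev.ne']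
      _ ≤ t := ht
  · intro p hp
    exact norm_dirPlaq_sub_one_le hξ0 hξ1 hα₀ hα₁ hdev hN0 hN hU hA hbase hδb hcov hsum hϱ hp
  · intro p hp
    have hσ : ‖((s.re : ℝ) : ℂ)‖ ≤ 1 + α₁' / dev := by
      rw [Complex.norm_real, Real.norm_eq_abs]; exact hre
    exact norm_dirPlaq_sub_one_le hξ0 hξ1 hα₀ hα₁ hdev hN0 hN hU hA hbase hδb hcov hsum hσ hp

/-- In particular the real segment itself lies in the tube (the centres of the discs). [folklore] -/
theorem ofReal_mem_dirTube {ξ α₀ α₁' t dev N δb : ℝ} {plaq : Set (ι × ι × ι × ι)} {A : ι → 𝔸} {U : ι → 𝔸ˣ}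
    (hξ0 : 0 < ξ) (hξ1 : ξ ≤ 1) (hα₀ : α₀ ≤ 1) (hα₁ : 0 ≤ α₁') (hdev : 0 < dev) (hN0 : 0 ≤ N) (hN : N ≤ dev)
    (hU : ∀ i, GUnit (U i)) (hA : ∀ i, ‖A i‖ ≤ N)
    (hbase : ∀ p ∈ plaq, ‖((basePlaqAt U p : 𝔸ˣ) : 𝔸) - 1‖ ≤ δb * ξ ^ 2) (hδb : δb ≤ α₀ / 2)
    (hcov : ∀ p ∈ plaq, ‖covSumAt A U p‖ ≤ 2 * ξ * N) (hsum : dev + α₁' ≤ α₀ / 8) (ht : dev + α₁' ≤ t)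
    {s₀ : ℝ} (hs₀ : s₀ ∈ Icc (0 : ℝ) 1) : (s₀ : ℂ) ∈ dirTube ξ α₀ α₁' t plaq A U N :=
  closedBall_subset_dirTube hξ0 hξ1 hα₀ hα₁ hdev hN0 hN hU hA hbase hδb hcov hsum ht hs₀
    (mem_closedBall_self (div_nonneg hα₁ hdev.le))

end Tube

/-! ## §5  The assembly relative to the base: `MeanLipschitz` from an analytic slice ON THE TUBE, and the
configuration-level leaf [bookkeeping] -/

section Assembly

variable {ι : Type*} {𝔸 : Type*} [NormedRing 𝔸] [NormedAlgebra ℂ 𝔸] [CompleteSpace 𝔸]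
variable {𝒰 β F : Type*} [NormedAddCommGroup F] [NormedSpace ℂ F] [CompleteSpace F]

/-- THE (β)-NODE HAND-OFF RE-BASED.  Data: a G-valued base `U` with plaquette curvature `≤ δ_bξ²` on `plaq`,
`δ_b ≤ α₀/2`; per exterior configuration `u ∈ dom` a direction `A u` with a gauge `0 ≤ N u ≤ dev u`, `‖A u i‖ ≤ N u`,
covariant plaquette sums `≤ 2ξ·N u`; the chart condition `dev u + α₁′ ≤ α₀/8` and `dev u + α₁′ ≤ t`; and — the one
ANALYTIC INPUT, a HYPOTHESIS — for `dev u > 0` and `b ∈ S` an analytic slice bounded by `B` ON THE TUBE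
`dirTube ξ α₀ α₁′ t plaq (A u) U (N u)` with endpoints `m u₀ b` (`s = 0`, the BASE) and `m u b` (`s = 1`), equal
means when `dev u = 0`.  Then `MeanLipschitz dom m S u₀ dev (4B/α₁′)` RELATIVE TO THE BASE `u₀` —
`T4AxialChain.meanLipschitz_of_segment` with its disc inclusion supplied by `closedBall_subset_dirTube`.  Nothing
printed is asserted. [folklore] -/
theorem meanLipschitz_chart {dom : Set 𝒰} {m : 𝒰 → β → F} {S : Finset β} {u₀ : 𝒰} {dev N : 𝒰 → ℝ}
    {A : 𝒰 → ι → 𝔸} {U : ι → 𝔸ˣ} {plaq : Set (ι × ι × ι × ι)} {ξ α₀ α₁' t δb B : ℝ}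
    (hξ0 : 0 < ξ) (hξ1 : ξ ≤ 1) (hα₀ : α₀ ≤ 1) (hα₁ : 0 < α₁') (hU : ∀ i, GUnit (U i))
    (hbase : ∀ p ∈ plaq, ‖((basePlaqAt U p : 𝔸ˣ) : 𝔸) - 1‖ ≤ δb * ξ ^ 2) (hδb : δb ≤ α₀ / 2)
    (hdev : ∀ u ∈ dom, 0 ≤ dev u) (hN0 : ∀ u ∈ dom, 0 ≤ N u) (hN : ∀ u ∈ dom, N u ≤ dev u)
    (hA : ∀ u ∈ dom, ∀ i, ‖A u i‖ ≤ N u) (hcov : ∀ u ∈ dom, ∀ p ∈ plaq, ‖covSumAt (A u) U p‖ ≤ 2 * ξ * N u)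
    (hsum : ∀ u ∈ dom, dev u + α₁' ≤ α₀ / 8) (ht : ∀ u ∈ dom, dev u + α₁' ≤ t)
    (hleaf : ∀ u ∈ dom, 0 < dev u → ∀ b ∈ S, ∃ g : ℂ → F, g 0 = m u₀ b ∧ g 1 = m u b ∧
      DifferentiableOn ℂ g (dirTube ξ α₀ α₁' t plaq (A u) U (N u)) ∧
      ∀ s ∈ dirTube ξ α₀ α₁' t plaq (A u) U (N u), ‖g s‖ ≤ B)
    (hflat : ∀ u ∈ dom, dev u = 0 → ∀ b ∈ S, m u b = m u₀ b) :
    T4FirstOrderSize.MeanLipschitz dom m S u₀ dev (4 * B / α₁') := by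
  refine T4AxialChain.meanLipschitz_of_segment hα₁ hdev (fun u hu hpos b hb => ?_) hflat
  obtain ⟨g, hg0, hg1, hg, hB⟩ := hleaf u hu hpos b hb
  exact ⟨g, dirTube ξ α₀ α₁' t plaq (A u) U (N u), hg0, hg1, hg, hB, fun s₀ hs₀ =>
    closedBall_subset_dirTube hξ0 hξ1 hα₀ hα₁.le hpos (hN0 u hu) (hN u hu) hU (hA u hu) hbase hδb (hcov u hu)
      (hsum u hu) (ht u hu) hs₀⟩

/-- THE MOVED CONFIGURATION at parameter `s` (the configuration-level chart): bond `i` carries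
`exp(iξs · A i) · U i`.  Intended reading (the cell's): the printed `𝐔′ = exp iξ𝐀U_{k+1}` with the direction scaled
by the complex coefficient `s`; nothing printed is asserted. [cite: Balaban1987RG1, (3.10) p. 272] -/
def dirConfig (ξ : ℝ) (A : ι → 𝔸) (U : ι → 𝔸ˣ) (s : ℂ) : ι → 𝔸 := fun i => exp (segScalar ξ s • A i) * (U i : 𝔸)

omit [CompleteSpace 𝔸] in
/-- The bond variable of the moved configuration, unfolded. [folklore] -/
theorem dirConfig_apply (ξ : ℝ) (A : ι → 𝔸) (U : ι → 𝔸ˣ) (s : ℂ) (i : ι) :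
    dirConfig ξ A U s i = exp (segScalar ξ s • A i) * (U i : 𝔸) :=
  rfl

omit [CompleteSpace 𝔸] in
/-- The moved configuration is the sibling's pure-potential segment configuration times the base, bondwise.
[folklore] -/
theorem dirConfig_eq_segConfig_mul (ξ : ℝ) (A : ι → 𝔸) (U : ι → 𝔸ˣ) (s : ℂ) (i : ι) :
    dirConfig ξ A U s i = T4MeanLipschitzBirth.segConfig ξ A s i * (U i : 𝔸) :=
  rfl

omit [CompleteSpace 𝔸] in
/-- The plaquette variables of the moved configuration are the `dirPlaq`'s of §4 (forward bonds from `dirConfig`,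
backward bonds carrying the inverse bond variables). [folklore] -/
theorem dirPlaq_eq_dirConfig (ξ : ℝ) (A : ι → 𝔸) (U : ι → 𝔸ˣ) (s : ℂ) (p : ι × ι × ι × ι) :
    dirPlaq (segScalar ξ s) A U p = dirConfig ξ A U s p.1 * dirConfig ξ A U s p.2.1 *
      ((((U p.2.2.1)⁻¹ : 𝔸ˣ) : 𝔸) * exp (-(segScalar ξ s • A p.2.2.1))) *
      ((((U p.2.2.2)⁻¹ : 𝔸ˣ) : 𝔸) * exp (-(segScalar ξ s • A p.2.2.2))) :=
  rfl

omit [CompleteSpace 𝔸] in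
/-- At `s = 0` the moved configuration is the base configuration. [folklore] -/
@[simp] theorem dirConfig_zero (ξ : ℝ) (A : ι → 𝔸) (U : ι → 𝔸ˣ) : dirConfig ξ A U 0 = baseConfig U := by
  funext i
  simp [dirConfig, baseConfig]

omit [CompleteSpace 𝔸] in
/-- A vanishing direction gives the base configuration at every parameter. [folklore] -/
theorem dirConfig_eq_base_of_eq_zero (ξ : ℝ) {A : ι → 𝔸} (hA : ∀ i, A i = 0) (U : ι → 𝔸ˣ) (s : ℂ) :
    dirConfig ξ A U s = baseConfig U := by
  funext i
  simp [dirConfig, baseConfig, hA i]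

/-- The moved configuration is an ENTIRE function of the parameter (finite bond set; coordinatewise the sibling's
`T4MeanLipschitzBirth.differentiable_segConfig` times a constant). [folklore] -/
theorem differentiable_dirConfig [Fintype ι] (ξ : ℝ) (A : ι → 𝔸) (U : ι → 𝔸ˣ) :
    Differentiable ℂ (dirConfig ξ A U) := by
  refine differentiable_pi.mpr fun i => ?_
  have h : Differentiable ℂ fun s => T4MeanLipschitzBirth.segConfig ξ A s i :=
    differentiable_pi.mp (T4MeanLipschitzBirth.differentiable_segConfig ξ A) i
  exact h.mul_const (U i : 𝔸)

/-- THE CONFIGURATION-LEVEL LEAF ⇒ `MeanLipschitz` RELATIVE TO THE BASE.  Hypotheses beyond the chart data of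
`meanLipschitz_chart`: a functional `Mc` on link configurations of the (finite) bond set, complex differentiable and
bounded by `B` (for the bonds `b ∈ S`) on a set `𝒞` of configurations which CONTAINS every moved configuration
`dirConfig ξ (A u) U s` with `s` in the tube of `u` (the instantiating seat's reading of the printed small-field
clauses — a HYPOTHESIS), and the set-up: `m u b = Mc (dirConfig ξ (A u) U 1) b` (the exterior `u ∈ dom` IS the
chart point `exp(iξ𝐀_u)U₀`) and `m u₀ b = Mc (baseConfig U) b` (the base).  The case `dev u = 0` forces `A u = 0`
and needs no separate hypothesis. [folklore] -/
theorem meanLipschitz_chart_of_class [Fintype ι] {dom : Set 𝒰} {m : 𝒰 → β → F} {S : Finset β} {u₀ : 𝒰}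
    {dev N : 𝒰 → ℝ} {A : 𝒰 → ι → 𝔸} {U : ι → 𝔸ˣ} {plaq : Set (ι × ι × ι × ι)} {ξ α₀ α₁' t δb B : ℝ}
    {𝒞 : Set (ι → 𝔸)} {Mc : (ι → 𝔸) → β → F}
    (hξ0 : 0 < ξ) (hξ1 : ξ ≤ 1) (hα₀ : α₀ ≤ 1) (hα₁ : 0 < α₁') (hU : ∀ i, GUnit (U i))
    (hbase : ∀ p ∈ plaq, ‖((basePlaqAt U p : 𝔸ˣ) : 𝔸) - 1‖ ≤ δb * ξ ^ 2) (hδb : δb ≤ α₀ / 2)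
    (hdev : ∀ u ∈ dom, 0 ≤ dev u) (hN0 : ∀ u ∈ dom, 0 ≤ N u) (hN : ∀ u ∈ dom, N u ≤ dev u)
    (hA : ∀ u ∈ dom, ∀ i, ‖A u i‖ ≤ N u) (hcov : ∀ u ∈ dom, ∀ p ∈ plaq, ‖covSumAt (A u) U p‖ ≤ 2 * ξ * N u)
    (hsum : ∀ u ∈ dom, dev u + α₁' ≤ α₀ / 8) (ht : ∀ u ∈ dom, dev u + α₁' ≤ t)
    (hMdiff : ∀ b ∈ S, DifferentiableOn ℂ (fun W => Mc W b) 𝒞)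
    (hMB : ∀ W ∈ 𝒞, ∀ b ∈ S, ‖Mc W b‖ ≤ B)
    (hclass : ∀ u ∈ dom, ∀ s ∈ dirTube ξ α₀ α₁' t plaq (A u) U (N u), dirConfig ξ (A u) U s ∈ 𝒞)
    (hm : ∀ u ∈ dom, ∀ b ∈ S, m u b = Mc (dirConfig ξ (A u) U 1) b)
    (hm₀ : ∀ b ∈ S, m u₀ b = Mc (baseConfig U) b) :
    T4FirstOrderSize.MeanLipschitz dom m S u₀ dev (4 * B / α₁') := by
  refine meanLipschitz_chart hξ0 hξ1 hα₀ hα₁ hU hbase hδb hdev hN0 hN hA hcov hsum ht ?_ ?_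
  · intro u hu _ b hb
    refine ⟨fun s => Mc (dirConfig ξ (A u) U s) b, ?_, ?_, ?_, ?_⟩
    · simp only [dirConfig_zero]; exact (hm₀ b hb).symm
    · exact (hm u hu b hb).symm
    · exact (hMdiff b hb).comp (differentiable_dirConfig ξ (A u) U).differentiableOn
        (fun s hs => hclass u hu s hs)
    · exact fun s hs => hMB _ (hclass u hu s hs) b hb
  · intro u hu h0 b hb
    have hN0' : N u = 0 := le_antisymm (h0 ▸ hN u hu) (hN0 u hu)
    have hA0 : ∀ i, A u i = 0 := fun i => norm_le_zero_iff.mp (hN0' ▸ hA u hu i)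
    rw [hm u hu b hb, dirConfig_eq_base_of_eq_zero ξ hA0, hm₀ b hb]

/-- … and with `MeanVanishes` AT THE BASE as an explicit HYPOTHESIS the conditional-mean suppression
`‖m u b‖ ≤ (4B/α₁′)·dev u` follows (`T4FirstOrderSize.condMeanSuppression_of_flat`, whose reference point is
arbitrary).  At a NON-FLAT base the vanishing of the mean is NOT the reflection/covariance consequence available at the
flat configuration; it stays the consumer's obligation. [folklore] -/
theorem condMeanSuppression_chart_of_class [Fintype ι] {dom : Set 𝒰} {m : 𝒰 → β → F} {S : Finset β} {u₀ : 𝒰}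
    {dev N : 𝒰 → ℝ} {A : 𝒰 → ι → 𝔸} {U : ι → 𝔸ˣ} {plaq : Set (ι × ι × ι × ι)} {ξ α₀ α₁' t δb B : ℝ}
    {𝒞 : Set (ι → 𝔸)} {Mc : (ι → 𝔸) → β → F}
    (hξ0 : 0 < ξ) (hξ1 : ξ ≤ 1) (hα₀ : α₀ ≤ 1) (hα₁ : 0 < α₁') (hU : ∀ i, GUnit (U i))
    (hbase : ∀ p ∈ plaq, ‖((basePlaqAt U p : 𝔸ˣ) : 𝔸) - 1‖ ≤ δb * ξ ^ 2) (hδb : δb ≤ α₀ / 2)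
    (hdev : ∀ u ∈ dom, 0 ≤ dev u) (hN0 : ∀ u ∈ dom, 0 ≤ N u) (hN : ∀ u ∈ dom, N u ≤ dev u)
    (hA : ∀ u ∈ dom, ∀ i, ‖A u i‖ ≤ N u) (hcov : ∀ u ∈ dom, ∀ p ∈ plaq, ‖covSumAt (A u) U p‖ ≤ 2 * ξ * N u)
    (hsum : ∀ u ∈ dom, dev u + α₁' ≤ α₀ / 8) (ht : ∀ u ∈ dom, dev u + α₁' ≤ t)
    (h0 : T4FirstOrderSize.MeanVanishes S (m u₀))
    (hMdiff : ∀ b ∈ S, DifferentiableOn ℂ (fun W => Mc W b) 𝒞)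
    (hMB : ∀ W ∈ 𝒞, ∀ b ∈ S, ‖Mc W b‖ ≤ B)
    (hclass : ∀ u ∈ dom, ∀ s ∈ dirTube ξ α₀ α₁' t plaq (A u) U (N u), dirConfig ξ (A u) U s ∈ 𝒞)
    (hm : ∀ u ∈ dom, ∀ b ∈ S, m u b = Mc (dirConfig ξ (A u) U 1) b)
    (hm₀ : ∀ b ∈ S, m u₀ b = Mc (baseConfig U) b) :
    T4FirstOrderSize.CondMeanSuppression dom m S dev (4 * B / α₁') :=
  T4FirstOrderSize.condMeanSuppression_of_flat h0
    (meanLipschitz_chart_of_class hξ0 hξ1 hα₀ hα₁ hU hbase hδb hdev hN0 hN hA hcov hsum ht hMdiff hMB hclass hm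
      hm₀)

end Assembly

end Literature.MathematicalPhysics.QuantumFieldTheory.Balaban1983to89.T4DirectionChart
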